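import Summits.CriticalPhenomena.PercolationContinuityZ3.Theorems.PercNearOneGluingNoHeavyLowerTailKernelTwoPlusTwo
import HarnessLib

/-!
# `NoHeavyLowerTail` (stmt-CriticalPhenomena-4575) — the `2 + (general law)` kernel REDUCES TO ITS FORMAL FACE

Support file (lemma factory `prim-lf-3` gen 7, seat g9; `--supports stmt-CriticalPhenomena-4575`).  No definitions, no named
facts, no sorries.  Memo: `run/shared/lean/prim/prim-lf-3/LF3-BETA-R.md` §11; lead memo `prim-nh-lead-4575/LEAD-GEN10.md` §3 (the
general-law kernel GL).

Setting of the general-law kernel with a 2-port star on one side: `o` a vertex isolated in the core `K`, `P = {p₁, p₂}` the ports of the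
star `x` (hairs `h₁, h₂ ∈ (0,1]`, `u = h₁h₂ < 1`), and on the other side an ARBITRARY nonnegative law `ν` on the subsets `Y` of a port set `Q`
(disjoint from `P ∪ {o}`); `G(T)` is the forced-star margin `μ_{K[o–T sure]}(o ↔ b) − μ_{K[o–T sure]}(j ↔ b)` (`= ([T] − j)_{K/T}` by
`forcedMargin_eq`).  The glued margin is the bilinear form
`F = Σ_Y ν(Y) [ (1−h₁)(1−h₂) G'(Y) + (1−h₁)h₂ G(Y+p₂) + h₁(1−h₂) G(Y+p₁) + h₁h₂ G(Y∪P) ]`, `G'(∅) = 0`, `G' = G` otherwise.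

* `twoPortSide_reduction` — if the two SPLIT ROWS of `p₁` and `p₂` hold (in the law-summed form of `arcCorner`) and the FORMAL FACE
  `Σ_Y ν(Y)[(1−u) G'(Y) + u G(Y ∪ P)]` is nonnegative, then `F ≥ 0`.  Proof: `F = c + d₁(h₁−u) + d₂(h₂−u)` is affine along the hyperbola
  `h₁h₂ = u` (`hyperbola_affine_ge_min3`), the two sure-hair corners are `arcCorner`, the formal corner is the hypothesis.  So for the
  general-law kernel with `|P_x| = 2` ONLY THE FORMAL FACE (`x` replaced by its two-atom law `{∅ : 1−u, P : u}`) REMAINS, for every law `ν`.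
* `kernel_twoPlusStar_of_formalFace` — the corollary for a one-layer observer `o` with ports `P ∪ Q` (product law on `Q`, any `|Q|`):
  the split rows of `p₁, p₂` plus the formal face give KN's inequality (41) `μ_W(j ↔ b, o ↔ A) ≤ μ_W(o ↔ b)`.  For `Q = {q₁, q₂}` the face is
  `ffCorner`/`mixedCorner` and the statement is `kernel_twoPlusTwo`.
-/

namespace Summit.CriticalPhenomena.PercolationContinuityZ3.Theorems

open MeasureTheory Set ProbabilityTheory
open Literature.Probability.LatticeModels
open Literature.Probability.Percolation

noncomputable section
open Classical

namespace UpsetExchange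

variable {n : ℕ}

/-- **The `2`-port side of the general-law kernel reduces to its formal face.**  See the module docstring.
[cite: KozmaNitzan2024, Question 9 (p. 36), Lemma 5 (p. 13)] -/
theorem twoPortSide_reduction (K : Sym2 (Fin n) → unitInterval) (o p₁ p₂ j b : Fin n) (Q : Finset (Fin n))
    (ν : Finset (Fin n) → ℝ) (hν : ∀ S ∈ Q.powerset, 0 ≤ ν S) (u : unitInterval) {h₁ h₂ : ℝ}
    (hh₁ : 0 < h₁) (hh₁' : h₁ ≤ 1) (hh₂ : 0 < h₂) (hh₂' : h₂ ≤ 1) (hprod : h₁ * h₂ = u) (hu1 : (u : ℝ) < 1)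
    (hoQ : o ∉ Q) (hp₁Q : p₁ ∉ Q) (hp₂Q : p₂ ∉ Q) (hp : p₁ ≠ p₂) (hop₁ : o ≠ p₁) (hop₂ : o ≠ p₂) (hjo : j ≠ o) (hbo : b ≠ o)
    (hisoK : ∀ u' : Fin n, u' ≠ o → K s(o, u') = 0)
    (G : Finset (Fin n) → ℝ)
    (hG : ∀ T : Finset (Fin n), G T =
      (prodBernoulli (fun f : Sym2 (Fin n) => if f ∈ T.image (fun t => s(o, t)) then 1 else K f)).real (openConn o b) -
        (prodBernoulli (fun f : Sym2 (Fin n) => if f ∈ T.image (fun t => s(o, t)) then 1 else K f)).real (openConn j b))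
    (hrow₁ : 0 ≤ ∑ S ∈ Q.powerset, ν S *
      ((1 - (u : ℝ)) * ((prodBernoulli (fun e : Sym2 (Fin n) => if (∀ x ∈ e, x ∈ S) ∧ ¬ e.IsDiag then 1 else K e)).real (openConn p₁ b) -
          (prodBernoulli (fun e : Sym2 (Fin n) => if (∀ x ∈ e, x ∈ S) ∧ ¬ e.IsDiag then 1 else K e)).real (openConn j b)) +
        (u : ℝ) * ((prodBernoulli (fun f : Sym2 (Fin n) => if f = s(p₁, p₂) then 1 else
              (if (∀ x ∈ f, x ∈ S) ∧ ¬ f.IsDiag then 1 else K f))).real (openConn p₁ b) -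
          (prodBernoulli (fun f : Sym2 (Fin n) => if f = s(p₁, p₂) then 1 else
              (if (∀ x ∈ f, x ∈ S) ∧ ¬ f.IsDiag then 1 else K f))).real (openConn j b))))
    (hrow₂ : 0 ≤ ∑ S ∈ Q.powerset, ν S *
      ((1 - (u : ℝ)) * ((prodBernoulli (fun e : Sym2 (Fin n) => if (∀ x ∈ e, x ∈ S) ∧ ¬ e.IsDiag then 1 else K e)).real (openConn p₂ b) -
          (prodBernoulli (fun e : Sym2 (Fin n) => if (∀ x ∈ e, x ∈ S) ∧ ¬ e.IsDiag then 1 else K e)).real (openConn j b)) +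
        (u : ℝ) * ((prodBernoulli (fun f : Sym2 (Fin n) => if f = s(p₂, p₁) then 1 else
              (if (∀ x ∈ f, x ∈ S) ∧ ¬ f.IsDiag then 1 else K f))).real (openConn p₂ b) -
          (prodBernoulli (fun f : Sym2 (Fin n) => if f = s(p₂, p₁) then 1 else
              (if (∀ x ∈ f, x ∈ S) ∧ ¬ f.IsDiag then 1 else K f))).real (openConn j b))))
    (hface : 0 ≤ ∑ Y ∈ Q.powerset, ν Y * ((1 - (u : ℝ)) * (if Y = ∅ then 0 else G Y) + (u : ℝ) * G (insert p₁ (insert p₂ Y)))) :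
    0 ≤ ∑ Y ∈ Q.powerset, ν Y *
        ((1 - h₁) * (1 - h₂) * (if Y = ∅ then 0 else G Y) + (1 - h₁) * h₂ * G (insert p₂ Y) +
          h₁ * (1 - h₂) * G (insert p₁ Y) + h₁ * h₂ * G (insert p₁ (insert p₂ Y))) := by
  obtain ⟨c, hc⟩ : ∃ c : ℝ, c = ∑ Y ∈ Q.powerset,
      ν Y * ((1 - (u : ℝ)) * (if Y = ∅ then 0 else G Y) + (u : ℝ) * G (insert p₁ (insert p₂ Y))) := ⟨_, rfl⟩
  obtain ⟨d₁, hd₁⟩ : ∃ d₁ : ℝ, d₁ = ∑ Y ∈ Q.powerset, ν Y * (G (insert p₁ Y) - (if Y = ∅ then 0 else G Y)) := ⟨_, rfl⟩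
  obtain ⟨d₂, hd₂⟩ : ∃ d₂ : ℝ, d₂ = ∑ Y ∈ Q.powerset, ν Y * (G (insert p₂ Y) - (if Y = ∅ then 0 else G Y)) := ⟨_, rfl⟩
  have hF : ∑ Y ∈ Q.powerset, ν Y *
        ((1 - h₁) * (1 - h₂) * (if Y = ∅ then 0 else G Y) + (1 - h₁) * h₂ * G (insert p₂ Y) +
          h₁ * (1 - h₂) * G (insert p₁ Y) + h₁ * h₂ * G (insert p₁ (insert p₂ Y))) =
      c + d₁ * (h₁ - u) + d₂ * (h₂ - u) := by
    rw [hc, hd₁, hd₂, Finset.sum_mul, Finset.sum_mul, ← Finset.sum_add_distrib, ← Finset.sum_add_distrib]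
    refine Finset.sum_congr rfl fun Y _ => ?_
    rw [← hprod]; ring
  have min3 : ∀ {a₁ a₂ a₃ x : ℝ}, 0 ≤ a₁ → 0 ≤ a₂ → 0 ≤ a₃ → min a₁ (min a₂ a₃) ≤ x → 0 ≤ x :=
    fun h1 h2 h3 h => (le_min h1 (le_min h2 h3)).trans h
  have hA₁ := arcCorner K o p₁ p₂ j b Q ν hν u hoQ hp₁Q hp₂Q hp hop₁ hop₂ hjo hbo hisoK G hG hrow₁
  have hA₂ := arcCorner K o p₂ p₁ j b Q ν hν u hoQ hp₂Q hp₁Q hp.symm hop₂ hop₁ hjo hbo hisoK G hG hrow₂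
  have hc0 : 0 ≤ c := by rw [hc]; exact hface
  have hc1 : 0 ≤ c + d₁ * (1 - (u : ℝ)) := by
    have e : c + d₁ * (1 - (u : ℝ)) = ∑ S ∈ Q.powerset,
        ν S * ((1 - (u : ℝ)) * G (insert p₁ S) + (u : ℝ) * G (insert p₂ (insert p₁ S))) := by
      rw [hc, hd₁, Finset.sum_mul, ← Finset.sum_add_distrib]
      refine Finset.sum_congr rfl fun Y _ => ?_
      rw [Finset.insert_comm p₁ p₂ Y]; ring
    rw [e]; exact hA₁
  have hc2 : 0 ≤ c + d₂ * (1 - (u : ℝ)) := by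
    have e : c + d₂ * (1 - (u : ℝ)) = ∑ S ∈ Q.powerset,
        ν S * ((1 - (u : ℝ)) * G (insert p₂ S) + (u : ℝ) * G (insert p₁ (insert p₂ S))) := by
      rw [hc, hd₂, Finset.sum_mul, ← Finset.sum_add_distrib]
      refine Finset.sum_congr rfl fun Y _ => ?_
      ring
    rw [e]; exact hA₂
  have hminx := hyperbola_affine_ge_min3 (c := c) (d₁ := d₁) (d₂ := d₂) (unitInterval.nonneg u) hu1 hh₁ hh₂ hh₁' hh₂' hprod
  rw [hF]
  exact min3 hc0 hc1 hc2 hminx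

/-- **The `2 + star` kernel given its formal face.**  A one-layer observer `o` with ports `{p₁, p₂} ∪ Q` (`Q` any finite port set,
product law of the hairs on `Q`), hairs `h₁, h₂ ∈ (0,1)` on `p₁, p₂`: the two split rows of `p₁, p₂` and the nonnegativity of the formal face
imply Kozma–Nitzan's inequality (41) at `o`.  See the module docstring; for `Q = {q₁, q₂}` this is `kernel_twoPlusTwo`.
[cite: KozmaNitzan2024, Question 9 (p. 36), Thm. 4–5 and Lemma 5 (pp. 12–14)] -/
theorem kernel_twoPlusStar_of_formalFace (W : Sym2 (Fin n) → unitInterval) (A Q : Finset (Fin n)) (o p₁ p₂ j b : Fin n)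
    (K : Sym2 (Fin n) → unitInterval) (hK : K = fun e => if o ∈ e then 0 else W e)
    (u : unitInterval) (hu : (u : ℝ) = (W s(o, p₁) : ℝ) * W s(o, p₂))
    (ν : Finset (Fin n) → ℝ) (hν : ∀ Y : Finset (Fin n), ν Y = (∏ q ∈ Y, (W s(o, q) : ℝ)) * ∏ q ∈ Q \ Y, (1 - (W s(o, q) : ℝ)))
    (G : Finset (Fin n) → ℝ)
    (hG : ∀ T : Finset (Fin n), G T =
      (prodBernoulli (fun f : Sym2 (Fin n) => if f ∈ T.image (fun t => s(o, t)) then 1 else K f)).real (openConn o b) -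
        (prodBernoulli (fun f : Sym2 (Fin n) => if f ∈ T.image (fun t => s(o, t)) then 1 else K f)).real (openConn j b))
    (hoA : o ∉ A) (hp₁A : p₁ ∈ A) (hp₂A : p₂ ∈ A) (hQA : Q ⊆ A) (hp₁Q : p₁ ∉ Q) (hp₂Q : p₂ ∉ Q) (hp : p₁ ≠ p₂)
    (hjo : j ≠ o) (hbo : b ≠ o)
    (hiso : ∀ u' : Fin n, u' ≠ o → u' ∉ insert p₁ (insert p₂ Q) → W s(o, u') = 0) (hloop : W s(o, o) = 0)
    (hh₁ : 0 < (W s(o, p₁) : ℝ)) (hh₁' : (W s(o, p₁) : ℝ) < 1) (hh₂ : 0 < (W s(o, p₂) : ℝ)) (hh₂' : (W s(o, p₂) : ℝ) < 1)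
    (hrow₁ : 0 ≤ ∑ S ∈ Q.powerset, ν S *
      ((1 - (u : ℝ)) * ((prodBernoulli (fun e : Sym2 (Fin n) => if (∀ x ∈ e, x ∈ S) ∧ ¬ e.IsDiag then 1 else K e)).real (openConn p₁ b) -
          (prodBernoulli (fun e : Sym2 (Fin n) => if (∀ x ∈ e, x ∈ S) ∧ ¬ e.IsDiag then 1 else K e)).real (openConn j b)) +
        (u : ℝ) * ((prodBernoulli (fun f : Sym2 (Fin n) => if f = s(p₁, p₂) then 1 else
              (if (∀ x ∈ f, x ∈ S) ∧ ¬ f.IsDiag then 1 else K f))).real (openConn p₁ b) -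
          (prodBernoulli (fun f : Sym2 (Fin n) => if f = s(p₁, p₂) then 1 else
              (if (∀ x ∈ f, x ∈ S) ∧ ¬ f.IsDiag then 1 else K f))).real (openConn j b))))
    (hrow₂ : 0 ≤ ∑ S ∈ Q.powerset, ν S *
      ((1 - (u : ℝ)) * ((prodBernoulli (fun e : Sym2 (Fin n) => if (∀ x ∈ e, x ∈ S) ∧ ¬ e.IsDiag then 1 else K e)).real (openConn p₂ b) -
          (prodBernoulli (fun e : Sym2 (Fin n) => if (∀ x ∈ e, x ∈ S) ∧ ¬ e.IsDiag then 1 else K e)).real (openConn j b)) +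
        (u : ℝ) * ((prodBernoulli (fun f : Sym2 (Fin n) => if f = s(p₂, p₁) then 1 else
              (if (∀ x ∈ f, x ∈ S) ∧ ¬ f.IsDiag then 1 else K f))).real (openConn p₂ b) -
          (prodBernoulli (fun f : Sym2 (Fin n) => if f = s(p₂, p₁) then 1 else
              (if (∀ x ∈ f, x ∈ S) ∧ ¬ f.IsDiag then 1 else K f))).real (openConn j b))))
    (hface : 0 ≤ ∑ Y ∈ Q.powerset, ν Y * ((1 - (u : ℝ)) * (if Y = ∅ then 0 else G Y) + (u : ℝ) * G (insert p₁ (insert p₂ Y)))) :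
    (prodBernoulli W).real (openConn j b ∩ ⋃ a ∈ A, openConn o a) ≤ (prodBernoulli W).real (openConn o b) := by
  -- (0) bookkeeping
  have hop₁ : o ≠ p₁ := fun h => hoA (h ▸ hp₁A)
  have hop₂ : o ≠ p₂ := fun h => hoA (h ▸ hp₂A)
  have hoQ : o ∉ Q := fun h => hoA (hQA h)
  have hPPA : insert p₁ (insert p₂ Q) ⊆ A :=
    Finset.insert_subset hp₁A (Finset.insert_subset hp₂A hQA)
  have hp₁n : p₁ ∉ insert p₂ Q := by rw [Finset.mem_insert, not_or]; exact ⟨hp, hp₁Q⟩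
  have hoPP : o ∉ insert p₁ (insert p₂ Q) := by
    rw [Finset.mem_insert, not_or, Finset.mem_insert, not_or]; exact ⟨hop₁, hop₂, hoQ⟩
  have hisoK : ∀ u' : Fin n, u' ≠ o → K s(o, u') = 0 := fun u' _ => by rw [hK]; simp
  have hνnn : ∀ S ∈ Q.powerset, 0 ≤ ν S := fun S _ => by
    rw [hν]
    exact mul_nonneg (Finset.prod_nonneg fun q _ => unitInterval.nonneg _)
      (Finset.prod_nonneg fun q _ => sub_nonneg.2 (unitInterval.le_one _))
  -- (1) the σ-law expansion in forced-star coordinates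
  have hexp := oneLayer_margin_eq_sum_forced W A (insert p₁ (insert p₂ Q)) o j b hoA hPPA hbo hiso hloop
  have hforced : ∀ T : Finset (Fin n),
      (fun e : Sym2 (Fin n) => if o ∈ e then (if ∃ p ∈ T, e = s(o, p) then (1 : unitInterval) else 0) else W e) =
        fun f => if f ∈ T.image (fun t => s(o, t)) then 1 else K f := by
    intro T; rw [forcedStar_eq_memForm W o T, hK]
  have hterm : ∀ B ∈ (insert p₁ (insert p₂ Q)).powerset,
      (if B = ∅ then (0 : ℝ) else
        (prodBernoulli W).real (starEvent o (↑B : Set (Fin n))) *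
          ((prodBernoulli (fun e : Sym2 (Fin n) => if o ∈ e then (if ∃ p ∈ B, e = s(o, p) then 1 else 0) else W e)).real
              (openConn o b) -
            (prodBernoulli (fun e : Sym2 (Fin n) => if o ∈ e then (if ∃ p ∈ B, e = s(o, p) then 1 else 0) else W e)).real
              (openConn j b))) =
      (if B = ∅ then (0 : ℝ) else
        ((∏ p ∈ B, (W s(o, p) : ℝ)) * ∏ u' ∈ insert p₁ (insert p₂ Q) \ B, (1 - (W s(o, u') : ℝ))) * G B) := by
    intro B hB
    by_cases hBe : B = ∅
    · rw [if_pos hBe, if_pos hBe]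
    · rw [if_neg hBe, if_neg hBe,
        real_starEvent_eq_prod_ports W o (insert p₁ (insert p₂ Q)) B hoPP (Finset.mem_powerset.1 hB) hiso, hforced B, hG B]
  have hexp' := hexp.trans (Finset.sum_congr rfl hterm)
  -- (2) expansion over the `x`-ports `p₁, p₂`
  have hS : ∑ B ∈ (insert p₁ (insert p₂ Q)).powerset, (if B = ∅ then (0 : ℝ) else
        ((∏ p ∈ B, (W s(o, p) : ℝ)) * ∏ u' ∈ insert p₁ (insert p₂ Q) \ B, (1 - (W s(o, u') : ℝ))) * G B) =
      ∑ Y ∈ Q.powerset, ν Y *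
        ((1 - (W s(o, p₁) : ℝ)) * (1 - (W s(o, p₂) : ℝ)) * (if Y = ∅ then 0 else G Y) +
          (1 - (W s(o, p₁) : ℝ)) * W s(o, p₂) * G (insert p₂ Y) +
          (W s(o, p₁) : ℝ) * (1 - (W s(o, p₂) : ℝ)) * G (insert p₁ Y) +
          (W s(o, p₁) : ℝ) * W s(o, p₂) * G (insert p₁ (insert p₂ Y))) := by
    rw [Finset.sum_powerset_insert hp₁n, Finset.sum_powerset_insert hp₂Q, Finset.sum_powerset_insert hp₂Q,
      ← Finset.sum_add_distrib, ← Finset.sum_add_distrib, ← Finset.sum_add_distrib]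
    refine Finset.sum_congr rfl fun Y hY => ?_
    have hYQ : Y ⊆ Q := Finset.mem_powerset.1 hY
    have hp₁Y : p₁ ∉ Y := fun h => hp₁Q (hYQ h)
    have hp₂Y : p₂ ∉ Y := fun h => hp₂Q (hYQ h)
    have hp₁Y₂ : p₁ ∉ insert p₂ Y := by rw [Finset.mem_insert, not_or]; exact ⟨hp, hp₁Y⟩
    have hp₂Y₁ : p₂ ∉ insert p₁ Y := by rw [Finset.mem_insert, not_or]; exact ⟨hp.symm, hp₂Y⟩
    have hp₁QY : p₁ ∉ Q \ Y := fun h => hp₁Q (Finset.mem_sdiff.1 h).1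
    have hp₂QY : p₂ ∉ Q \ Y := fun h => hp₂Q (Finset.mem_sdiff.1 h).1
    have hp₁QY₂ : p₁ ∉ insert p₂ (Q \ Y) := by rw [Finset.mem_insert, not_or]; exact ⟨hp, hp₁QY⟩
    have ea : insert p₁ (insert p₂ Q) \ Y = insert p₁ (insert p₂ (Q \ Y)) := by
      rw [Finset.insert_sdiff_of_notMem _ hp₁Y, Finset.insert_sdiff_of_notMem _ hp₂Y]
    have eb : insert p₁ (insert p₂ Q) \ insert p₂ Y = insert p₁ (Q \ Y) := by
      rw [Finset.insert_sdiff_of_notMem _ hp₁Y₂, Finset.insert_sdiff_insert, Finset.sdiff_insert_of_notMem hp₂Q]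
    have ec : insert p₁ (insert p₂ Q) \ insert p₁ Y = insert p₂ (Q \ Y) := by
      rw [Finset.insert_sdiff_insert, Finset.insert_sdiff_of_notMem _ hp₂Y₁, Finset.sdiff_insert_of_notMem hp₁Q]
    have ed : insert p₁ (insert p₂ Q) \ insert p₁ (insert p₂ Y) = Q \ Y := by
      rw [Finset.insert_sdiff_insert,
        Finset.insert_sdiff_of_mem _ (Finset.mem_insert_of_mem (Finset.mem_insert_self p₂ Y)),
        Finset.sdiff_insert_of_notMem hp₁Q, Finset.sdiff_insert_of_notMem hp₂Q]
    rw [if_neg (Finset.insert_ne_empty p₂ Y), if_neg (Finset.insert_ne_empty p₁ Y),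
      if_neg (Finset.insert_ne_empty p₁ (insert p₂ Y)), ea, eb, ec, ed,
      Finset.prod_insert hp₁Y₂, Finset.prod_insert hp₂Y, Finset.prod_insert hp₁Y,
      Finset.prod_insert hp₁QY₂, Finset.prod_insert hp₂QY, Finset.prod_insert hp₁QY, hν Y]
    by_cases hYe : Y = ∅
    · rw [if_pos hYe, if_pos hYe]; ring
    · rw [if_neg hYe, if_neg hYe]; ring
  -- (3) the reduction
  have hu1 : (u : ℝ) < 1 := by rw [hu]; exact mul_lt_one_of_nonneg_of_lt_one_left hh₁.le hh₁' hh₂'.le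
  have hfin := twoPortSide_reduction K o p₁ p₂ j b Q ν hνnn u hh₁ hh₁'.le hh₂ hh₂'.le hu.symm hu1
    hoQ hp₁Q hp₂Q hp hop₁ hop₂ hjo hbo hisoK G hG hrow₁ hrow₂ hface
  have htot : 0 ≤ (prodBernoulli W).real (openConn o b) -
      (prodBernoulli W).real (openConn j b ∩ ⋃ a ∈ A, openConn o a) := by
    rw [hexp', hS]; exact hfin
  exact sub_nonneg.1 htot

end UpsetExchange

end

end Summit.CriticalPhenomena.PercolationContinuityZ3.Theorems
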